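import Summits.KontsevichZagierPeriods.KontsevichZagierPeriods.Theses.TerasomaMultiplication
import Summits.KontsevichZagierPeriods.KontsevichZagierPeriods.Theorems.CompleteModGammaSector.Negative.LoadBearing
import Summits.KontsevichZagierPeriods.KontsevichZagierPeriods.Theorems.FurushoPentagonSectorToKernelCubeResolutionOfNash
import Summits.KontsevichZagierPeriods.KontsevichZagierPeriods.Theorems.HurwitzMicroSectorsNormalFormPrincipleSplitGlue
import Literature.NumberTheory.Transcendental.KZCalculusProofs
import Literature.NumberTheory.Transcendental.KZUnfolding
import Literature.NumberTheory.Transcendental.KZProductIdeal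
import Summits.KontsevichZagierPeriods.KontsevichZagierPeriods.Theorems.TerasomaMultiplicationBetaCancellationOfAyoubPiCancellation

/-!
# `CompleteModGammaSector` (stmt-KontsevichZagierPeriods-14233): the AYOUB–π SPLIT — a typed
decomposition into three leaves with a proved, non-trivial assembly

Crux strategist `cstrat-stmt-KontsevichZagierPeriods-14233-r1` (EXEMPT-46 re-exam, 2026-08-17). The crux
`X = CompleteModGammaSector` is Conjecture 1 of Kontsevich–Zagier RELATIVE to the Deligne–Koblitz–Ogus
Γ-identities: `X ↔ ker eval ≤ sector`, `sector := relations ⊔ closure gammaHodgePairs`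
(`CompleteModGammaSectorNegative.completeModGammaSector_iff_ker_le`). Two absorption theorems forbid
the obvious cuts: RESIDUAL ABSORPTION (`…ResidualAbsorption.completeModGammaSector_iff_residual_of_le_sector`:
every residual `ker eval ≤ sector ⊔ S` with `S ≤ sector` is `X` again) and ZERO ABSORPTION (this file,
`completeModGammaSector_iff_zeroForm`: `X` is already its own restriction to SINGLE representations of
value `0`, so every cut one of whose pieces says "value-zero / algebraically-valued representations
compress to a point" — the degree cut of route HodgeColevel included — has that piece equal to `X`).
What survives is the product of the two classical factorisations of the period conjecture, written
inside the calculus of moves: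

* **normal form** (Ayoub 2014, Rem. 12–13; Huber–Müller-Stach 2017, Lemma 11.2.3): pass to
  `ℤ`-combinations of TAME CUBE classes `[[0,1]ⁿ, g]`, `g` Nash (analytic near the closed cube) —
  leaf 1 `CubeNashNormalForm`, VERBATIM the existing item stmt-KontsevichZagierPeriods-3574
  (route LiftingCriteria; geometry: Nash cell decomposition + rectilinearisation, Hironaka /
  Bierstone–Milman strength; its dimension `≤ 1` case is landed, `cubeResolution_dimLEOne`);
* **localisation at `[π]`** (Kontsevich–Zagier 2001 §4.1; Ayoub 2014 Conj. 7; Huber–Wüstholz 2022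
  App. A.4): leaf 2 `CubicalPiLocalKernelModGamma` — Ayoub's effective cube kernel, LOCALISED at the
  disc class and taken modulo Γ (every value-zero cubical class becomes Γ-accessible after finitely
  many disc factors: the statement on which torsor / motivic-Galois methods act at all), and leaf 3
  `PiCancellationModGamma` — the disc class is a non-zero-divisor modulo `sector` (item 0540 with
  `relations ↦ sector`; transcendence-free; its motivic shadow `P̃(MM^eff) → P̃(MM)` injective is
  printed OPEN, Huber–Wüstholz 2022 App. A.4).

Assembly `completeModGammaSector_of_ayoubPiSplit` (PROVED, sorry-free): kernel form → difference of
two representations (`KZ.exists_integralRep_sub_holds`) → cubical resolution of both from leaf 1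
(`SectorToKernel.cubeResolution_of_cubeNashNormalForm`, landed: rational shape by the graph trick,
Nash integrands re-based on tame cubes) → a value-zero element of the cubical span (soundness) → a
pinned disc-product operator EXISTS (`NormalFormPrincipleSplitGlue.exists_pinnedProduct`, landed;
nothing is consumed vacuously) → leaf 2 gives `[π]^N a ∈ sector` → leaf 3 peels the `N` disc factors
(induction) → `c ∈ sector`. Each leaf is load-bearing; none is `X` or the summit by a cheap probe
(`bc/*_probe.lean` of the strategist folder), none carries a landed `iff` with `X`; leaves 2 and 3 are
`X`-implied (`cubicalPiLocalKernelModGamma_of_crux`, `piCancellationModGamma_of_crux`), leaf 1 is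
summit-free geometry.

References: Kontsevich–Zagier 2001 §1.2, §4.1; Ayoub, EMS Newsl. 91 (2014) Def. 9–10, Prop. 11,
Rem. 12–13, Conj. 7; Ayoub, Ann. of Math. 181 (2015) Conj. 1.1; Huber–Wüstholz 2022 App. A.4;
Huber–Müller-Stach 2017 Lemma 11.2.3, Rem. 13.1.8; Bierstone–Milman 1988 (rectilinearisation).
-/

noncomputable section

set_option linter.dupNamespace false

namespace Summit.KontsevichZagierPeriods.KontsevichZagierPeriods.Cruxes.CompleteModGammaSector.AyoubPiSplitLine

open MeasureTheory Set
open Literature.NumberTheory.Transcendental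
open Literature.NumberTheory.Transcendental.KZ hiding cubicalSpan
open Summit.KontsevichZagierPeriods.KontsevichZagierPeriods.Theses.TerasomaMultiplication
  (CompleteModGammaSector)
open Summit.KontsevichZagierPeriods.CompleteModGammaSectorNegative
  (sector gammaHodgePairs completeModGammaSector_iff_ker_le sector_le_ker_eval)
open Summit.KontsevichZagierPeriods.FurushoPentagon.ReducedPeriodRing (cubicalGens cubicalSpan)
open Summit.KontsevichZagierPeriods.FurushoPentagon.SectorToKernel (cubeResolution_of_cubeNashNormalForm)
open Summit.KontsevichZagierPeriods.HurwitzMicroSectors.NormalFormPrincipleSplitGlue (exists_pinnedProduct)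
open Summit.KontsevichZagierPeriods.KontsevichZagierPeriods.BetaCancellationLine (piRep_mul_sub_lift_mem_relations)

/-! ## The three leaves, verbatim as filed (route-file vocabulary only: `sector` and the tame-cube
generators are inlined; the disc product is pinned as in items 0540/0541) -/

/-- **Leaf 1 — cube-Nash normal form** = item stmt-KontsevichZagierPeriods-3574
(`LiftingCriteria.CubeNashNormalForm`) VERBATIM: every difference of rational-shape representations is
KZ-equivalent to a `ℤ`-combination of cube representations with Nash integrands analytic on a
neighbourhood of the closed cube. Summit-free geometry (Nash cell decomposition + rectilinearisation).
[cite: Ayoub2014, Rem. 12] [cite: HuberMullerStachPeriods2017, Lemma 11.2.3] -/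
def CubeNashNormalForm : Prop :=
  ∀ (k k' : ℕ) (r : Literature.NumberTheory.Transcendental.KZ.IntegralRep k) (r' : Literature.NumberTheory.Transcendental.KZ.IntegralRep k'), r.IsRational → r'.IsRational → ∃ (S : ℕ) (n : Fin S → ℕ) (g : (i : Fin S) → (Fin (n i) → ℝ) → ℝ) (U : (i : Fin S) → Set (Fin (n i) → ℝ)) (ε : Fin S → ℤ) (s : (i : Fin S) → Literature.NumberTheory.Transcendental.KZ.IntegralRep (n i)), (∀ i, IsOpen (U i) ∧ Set.pi Set.univ (fun _ : Fin (n i) => Set.Icc (0:ℝ) 1) ⊆ (U i) ∧ Literature.NumberTheory.Transcendental.IsSemialgebraicFunOn ℚ (U i) (g i) ∧ AnalyticOnNhd ℝ (g i) (U i)) ∧ (∀ i, (s i).domain = Set.pi Set.univ (fun _ : Fin (n i) => Set.Icc (0:ℝ) 1) ∧ ∀ z ∈ Set.pi Set.univ (fun _ : Fin (n i) => Set.Icc (0:ℝ) 1), (s i).integrand z = g i z) ∧ Literature.NumberTheory.Transcendental.KZ.of r - Literature.NumberTheory.Transcendental.KZ.of r' - ∑ i, ε i • Literature.NumberTheory.Transcendental.KZ.of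 (s i) ∈ Literature.NumberTheory.Transcendental.KZ.relations

/-- **Leaf 2 — Ayoub's effective cube kernel, localised at `[π]`, modulo Γ.** For every pinned
disc-product operator `P` (`[r] ↦ [disc × r]`, the pinning of items 0540/0541) and every element `a`
of the CUBICAL SPAN (the subgroup generated by tame cube classes `[[0,1]ⁿ, g]`, `g` analytic near the
closed cube) with `eval a = 0`, some iterate `[π]^N a` lies in `sector = relations ⊔ closure(Γ-Hodge
pair differences)` (inlined). [cite: Ayoub2014, Conj. 7] [cite: KontsevichZagier2001, §4.1] -/
def CubicalPiLocalKernelModGamma : Prop :=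
  ∀ (P : ∀ n : ℕ, Literature.NumberTheory.Transcendental.KZ.IntegralRep n → Literature.NumberTheory.Transcendental.KZ.IntegralRep (n + 2)), (∀ (n : ℕ) (r : Literature.NumberTheory.Transcendental.KZ.IntegralRep n), (P n r).domain = {z : Fin (n + 2) → ℝ | z 0 ^ 2 + z 1 ^ 2 ≤ 1 ∧ (fun i : Fin n => z i.succ.succ) ∈ r.domain} ∧ (P n r).integrand = fun z => r.integrand (fun i : Fin n => z i.succ.succ)) → ∀ a ∈ AddSubgroup.closure {d : Literature.NumberTheory.Transcendental.KZ.FormalRep | ∃ (n : ℕ) (ρ : Literature.NumberTheory.Transcendental.KZ.IntegralRep n), ρ.domain = {x | ∀ i, 0 ≤ x i ∧ x i ≤ 1} ∧ AnalyticOnNhd ℝ ρ.integrand {x | ∀ i, 0 ≤ x i ∧ x i ≤ 1} ∧ d = Literature.NumberTheory.Transcendental.KZ.of ρ}, Literature.NumberTheory.Transcendental.KZ.eval a = 0 → ∃ N : ℕ, (⇑(FreeAbelianGroup.lift (fun s : (Σ n, Literature.NumberTheory.Transcendental.KZ.IntegralRep n) => Literature.NumberTheory.Transcendental.KZ.of (P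 s.1 s.2))))^[N] a ∈ (Literature.NumberTheory.Transcendental.KZ.relations ⊔ AddSubgroup.closure {d : Literature.NumberTheory.Transcendental.KZ.FormalRep | ∃ (N N' k : ℕ) (x y : Fin N → ℚ) (x' y' : Fin N' → ℚ) (c : ℝ) (ρ : Literature.NumberTheory.Transcendental.KZ.IntegralRep N) (ρ' : Literature.NumberTheory.Transcendental.KZ.IntegralRep (2 * k + N')), (∀ j, 0 < x j ∧ 0 < y j ∧ Int.fract (x j) ≠ 0 ∧ Int.fract (y j) ≠ 0) ∧ (∀ l, 0 < x' l ∧ 0 < y' l ∧ Int.fract (x' l) ≠ 0 ∧ Int.fract (y' l) ≠ 0) ∧ (∀ u : ℕ, 0 < u → (∀ j, Nat.Coprime u (x j).den ∧ Nat.Coprime u (y j).den) → (∀ l, Nat.Coprime u (x' l).den ∧ Nat.Coprime u (y' l).den) → ((∑ j, (Int.fract ((u : ℚ) * x j) + Int.fract ((u : ℚ) * y j) - Int.fract ((u : ℚ) * (x j + y j)))) - ∑ l, (Int.fract ((u : ℚ) * x' l) + Int.fract ((u : ℚ) * y' l) - Int.fract ((u : ℚ) * (x' l + y' l)))) = (k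 : ℚ)) ∧ IsAlgebraic ℚ c ∧ ρ.domain = {t | ∀ j, t j ∈ Set.Ioo (0:ℝ) 1} ∧ Set.EqOn ρ.integrand (fun t => ∏ j, (t j) ^ ((x j : ℝ) - 1) * (1 - t j) ^ ((y j : ℝ) - 1)) ρ.domain ∧ ρ'.domain = {z | (∑ i : Fin (2 * k), (z (Fin.castAdd N' i)) ^ 2) < 1 ∧ ∀ l : Fin N', z (Fin.natAdd (2 * k) l) ∈ Set.Ioo (0:ℝ) 1} ∧ Set.EqOn ρ'.integrand (fun z => c * (k.factorial : ℝ) * ∏ l, (z (Fin.natAdd (2 * k) l)) ^ ((x' l : ℝ) - 1) * (1 - z (Fin.natAdd (2 * k) l)) ^ ((y' l : ℝ) - 1)) ρ'.domain ∧ ρ.value = ρ'.value ∧ d = Literature.NumberTheory.Transcendental.KZ.of ρ - Literature.NumberTheory.Transcendental.KZ.of ρ'})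

/-- **Leaf 3 — `[π]`-cancellation modulo Γ**: the disc class is a non-zero-divisor on
`FormalRep ⧸ sector` — item stmt-KontsevichZagierPeriods-0540 (`AyoubPiCancellation`) with
`relations` replaced by `sector` (inlined). Transcendence-free; motivic shadow printed open.
[cite: HuberWustholz2022, App. A.4] [cite: Ayoub2014, Conj. 7] -/
def PiCancellationModGamma : Prop :=
  ∀ (P : ∀ n : ℕ, Literature.NumberTheory.Transcendental.KZ.IntegralRep n → Literature.NumberTheory.Transcendental.KZ.IntegralRep (n + 2)), (∀ (n : ℕ) (r : Literature.NumberTheory.Transcendental.KZ.IntegralRep n), (P n r).domain = {z : Fin (n + 2) → ℝ | z 0 ^ 2 + z 1 ^ 2 ≤ 1 ∧ (fun i : Fin n => z i.succ.succ) ∈ r.domain} ∧ (P n r).integrand = fun z => r.integrand (fun i : Fin n => z i.succ.succ)) → ∀ c : Literature.NumberTheory.Transcendental.KZ.FormalRep, FreeAbelianGroup.lift (fun s : (Σ n, Literature.NumberTheory.Transcendental.KZ.IntegralRep n) => Literature.NumberTheory.Transcendental.KZ.of (P s.1 s.2)) c ∈ (Literature.NumberTheory.Transcendental.KZ.relations ⊔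 AddSubgroup.closure {d : Literature.NumberTheory.Transcendental.KZ.FormalRep | ∃ (N N' k : ℕ) (x y : Fin N → ℚ) (x' y' : Fin N' → ℚ) (c : ℝ) (ρ : Literature.NumberTheory.Transcendental.KZ.IntegralRep N) (ρ' : Literature.NumberTheory.Transcendental.KZ.IntegralRep (2 * k + N')), (∀ j, 0 < x j ∧ 0 < y j ∧ Int.fract (x j) ≠ 0 ∧ Int.fract (y j) ≠ 0) ∧ (∀ l, 0 < x' l ∧ 0 < y' l ∧ Int.fract (x' l) ≠ 0 ∧ Int.fract (y' l) ≠ 0) ∧ (∀ u : ℕ, 0 < u → (∀ j, Nat.Coprime u (x j).den ∧ Nat.Coprime u (y j).den) → (∀ l, Nat.Coprime u (x' l).den ∧ Nat.Coprime u (y' l).den) → ((∑ j, (Int.fract ((u : ℚ) * x j) + Int.fract ((u : ℚ) * y j) - Int.fract ((u : ℚ) * (x j + y j)))) - ∑ l, (Int.fract ((u : ℚ) * x' l) + Int.fract ((u : ℚ) * y' l) - Int.fract ((u : ℚ) * (x' l + y' l)))) = (k : ℚ)) ∧ IsAlgebraic ℚ c ∧ ρ.domain = {t | ∀ j, t j ∈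 Set.Ioo (0:ℝ) 1} ∧ Set.EqOn ρ.integrand (fun t => ∏ j, (t j) ^ ((x j : ℝ) - 1) * (1 - t j) ^ ((y j : ℝ) - 1)) ρ.domain ∧ ρ'.domain = {z | (∑ i : Fin (2 * k), (z (Fin.castAdd N' i)) ^ 2) < 1 ∧ ∀ l : Fin N', z (Fin.natAdd (2 * k) l) ∈ Set.Ioo (0:ℝ) 1} ∧ Set.EqOn ρ'.integrand (fun z => c * (k.factorial : ℝ) * ∏ l, (z (Fin.natAdd (2 * k) l)) ^ ((x' l : ℝ) - 1) * (1 - z (Fin.natAdd (2 * k) l)) ^ ((y' l : ℝ) - 1)) ρ'.domain ∧ ρ.value = ρ'.value ∧ d = Literature.NumberTheory.Transcendental.KZ.of ρ - Literature.NumberTheory.Transcendental.KZ.of ρ'}) → c ∈ (Literature.NumberTheory.Transcendental.KZ.relations ⊔ AddSubgroup.closure {d : Literature.NumberTheory.Transcendental.KZ.FormalRep | ∃ (N N' k : ℕ) (x y : Fin N → ℚ) (x' y' : Fin N' → ℚ) (c : ℝ) (ρ : Literature.NumberTheory.Transcendental.KZ.IntegralRep N) (ρ' : Literature.NumberTheory.Transcendental.KZ.IntegralRep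 (2 * k + N')), (∀ j, 0 < x j ∧ 0 < y j ∧ Int.fract (x j) ≠ 0 ∧ Int.fract (y j) ≠ 0) ∧ (∀ l, 0 < x' l ∧ 0 < y' l ∧ Int.fract (x' l) ≠ 0 ∧ Int.fract (y' l) ≠ 0) ∧ (∀ u : ℕ, 0 < u → (∀ j, Nat.Coprime u (x j).den ∧ Nat.Coprime u (y j).den) → (∀ l, Nat.Coprime u (x' l).den ∧ Nat.Coprime u (y' l).den) → ((∑ j, (Int.fract ((u : ℚ) * x j) + Int.fract ((u : ℚ) * y j) - Int.fract ((u : ℚ) * (x j + y j)))) - ∑ l, (Int.fract ((u : ℚ) * x' l) + Int.fract ((u : ℚ) * y' l) - Int.fract ((u : ℚ) * (x' l + y' l)))) = (k : ℚ)) ∧ IsAlgebraic ℚ c ∧ ρ.domain = {t | ∀ j, t j ∈ Set.Ioo (0:ℝ) 1} ∧ Set.EqOn ρ.integrand (fun t => ∏ j, (t j) ^ ((x j : ℝ) - 1) * (1 - t j) ^ ((y j : ℝ) - 1)) ρ.domain ∧ ρ'.domain = {z | (∑ i : Fin (2 * k), (z (Fin.castAdd N' i)) ^ 2) < 1 ∧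 ∀ l : Fin N', z (Fin.natAdd (2 * k) l) ∈ Set.Ioo (0:ℝ) 1} ∧ Set.EqOn ρ'.integrand (fun z => c * (k.factorial : ℝ) * ∏ l, (z (Fin.natAdd (2 * k) l)) ^ ((x' l : ℝ) - 1) * (1 - z (Fin.natAdd (2 * k) l)) ^ ((y' l : ℝ) - 1)) ρ'.domain ∧ ρ.value = ρ'.value ∧ d = Literature.NumberTheory.Transcendental.KZ.of ρ - Literature.NumberTheory.Transcendental.KZ.of ρ'})

/-! ## Bridges: the inlined vocabulary is the tree's vocabulary, definitionally -/

/-- The inlined sector is `CompleteModGammaSectorNegative.sector`. [folklore] -/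
theorem inlinedSector_eq :
    (Literature.NumberTheory.Transcendental.KZ.relations ⊔ AddSubgroup.closure {d : Literature.NumberTheory.Transcendental.KZ.FormalRep | ∃ (N N' k : ℕ) (x y : Fin N → ℚ) (x' y' : Fin N' → ℚ) (c : ℝ) (ρ : Literature.NumberTheory.Transcendental.KZ.IntegralRep N) (ρ' : Literature.NumberTheory.Transcendental.KZ.IntegralRep (2 * k + N')), (∀ j, 0 < x j ∧ 0 < y j ∧ Int.fract (x j) ≠ 0 ∧ Int.fract (y j) ≠ 0) ∧ (∀ l, 0 < x' l ∧ 0 < y' l ∧ Int.fract (x' l) ≠ 0 ∧ Int.fract (y' l) ≠ 0) ∧ (∀ u : ℕ, 0 < u → (∀ j, Nat.Coprime u (x j).den ∧ Nat.Coprime u (y j).den) → (∀ l, Nat.Coprime u (x' l).den ∧ Nat.Coprime u (y' l).den) → ((∑ j, (Int.fract ((u : ℚ) * x j) + Int.fract ((u : ℚ) * y j) - Int.fract ((u : ℚ) * (x j + y j)))) - ∑ l, (Int.fract ((u : ℚ) * x' l) + Int.fract ((u : ℚ) * y' l) - Int.fract ((u : ℚ) * (x' l + y' l)))) = (k : ℚ))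 ∧ IsAlgebraic ℚ c ∧ ρ.domain = {t | ∀ j, t j ∈ Set.Ioo (0:ℝ) 1} ∧ Set.EqOn ρ.integrand (fun t => ∏ j, (t j) ^ ((x j : ℝ) - 1) * (1 - t j) ^ ((y j : ℝ) - 1)) ρ.domain ∧ ρ'.domain = {z | (∑ i : Fin (2 * k), (z (Fin.castAdd N' i)) ^ 2) < 1 ∧ ∀ l : Fin N', z (Fin.natAdd (2 * k) l) ∈ Set.Ioo (0:ℝ) 1} ∧ Set.EqOn ρ'.integrand (fun z => c * (k.factorial : ℝ) * ∏ l, (z (Fin.natAdd (2 * k) l)) ^ ((x' l : ℝ) - 1) * (1 - z (Fin.natAdd (2 * k) l)) ^ ((y' l : ℝ) - 1)) ρ'.domain ∧ ρ.value = ρ'.value ∧ d = Literature.NumberTheory.Transcendental.KZ.of ρ - Literature.NumberTheory.Transcendental.KZ.of ρ'}) = sector := rfl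

/-- The inlined tame-cube generator set is `ReducedPeriodRing.cubicalGens`. [folklore] -/
theorem inlinedCubicalGens_eq :
    {d : Literature.NumberTheory.Transcendental.KZ.FormalRep | ∃ (n : ℕ) (ρ : Literature.NumberTheory.Transcendental.KZ.IntegralRep n), ρ.domain = {x | ∀ i, 0 ≤ x i ∧ x i ≤ 1} ∧ AnalyticOnNhd ℝ ρ.integrand {x | ∀ i, 0 ≤ x i ∧ x i ≤ 1} ∧ d = Literature.NumberTheory.Transcendental.KZ.of ρ} = cubicalGens := rfl

/-- The pinning hypothesis of items 0540/0541, as a predicate on operators `P`. [folklore] -/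
def IsPinnedDisc (P : ∀ n : ℕ, IntegralRep n → IntegralRep (n + 2)) : Prop :=
  ∀ (n : ℕ) (r : IntegralRep n), (P n r).domain = {z : Fin (n + 2) → ℝ | z 0 ^ 2 + z 1 ^ 2 ≤ 1 ∧
    (fun i : Fin n => z i.succ.succ) ∈ r.domain} ∧
    (P n r).integrand = fun z => r.integrand (fun i : Fin n => z i.succ.succ)

/-- The additive extension `[r] ↦ [P r]` of a pinned operator to formal combinations. [folklore] -/
def liftP (P : ∀ n : ℕ, IntegralRep n → IntegralRep (n + 2)) : FormalRep →+ FormalRep :=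
  FreeAbelianGroup.lift (fun s : (Σ n, IntegralRep n) => of (P s.1 s.2))

/-- Leaf 2, unfolded through the bridges. [folklore] -/
theorem cubicalPiLocalKernelModGamma_iff :
    CubicalPiLocalKernelModGamma ↔
      ∀ P, IsPinnedDisc P → ∀ a ∈ cubicalSpan, eval a = 0 → ∃ N : ℕ, (liftP P)^[N] a ∈ sector :=
  Iff.rfl

/-- Leaf 3, unfolded through the bridges. [folklore] -/
theorem piCancellationModGamma_iff :
    PiCancellationModGamma ↔ ∀ P, IsPinnedDisc P → ∀ c : FormalRep, liftP P c ∈ sector → c ∈ sector :=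
  Iff.rfl

/-! ## The assembly -/

/-- Peeling: under `[π]`-cancellation modulo Γ, `[π]^N x ∈ sector` forces `x ∈ sector`. [folklore] -/
theorem mem_sector_of_iterate_mem {P : ∀ n : ℕ, IntegralRep n → IntegralRep (n + 2)}
    (hcanc : ∀ c : FormalRep, liftP P c ∈ sector → c ∈ sector) :
    ∀ (N : ℕ) (x : FormalRep), (liftP P)^[N] x ∈ sector → x ∈ sector
  | 0, _, h => h
  | N + 1, x, h => by
    rw [Function.iterate_succ_apply'] at h
    exact mem_sector_of_iterate_mem hcanc N x (hcanc _ h)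

/-- **Cubical resolution of a formal combination** (leaf 1 + the landed
`cubeResolution_of_cubeNashNormalForm` + `exists_integralRep_sub`): every formal combination is
congruent modulo the KZ relations to an element of the cubical span. [cite: Ayoub2014, Rem. 12] -/
theorem exists_cubical_of_cubeNashNormalForm (h₁ : CubeNashNormalForm) (c : FormalRep) :
    ∃ a ∈ cubicalSpan, c - a ∈ relations := by
  obtain ⟨n, m, r, r', hrel⟩ := exists_integralRep_sub_holds c
  obtain ⟨a₁, ha₁, h1⟩ := cubeResolution_of_cubeNashNormalForm h₁ n r
  obtain ⟨a₂, ha₂, h2⟩ := cubeResolution_of_cubeNashNormalForm h₁ m r'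
  refine ⟨a₁ - a₂, cubicalSpan.sub_mem ha₁ ha₂, ?_⟩
  have : c - (a₁ - a₂) = (c - (of r - of r')) + (of r - a₁) - (of r' - a₂) := by abel
  rw [this]
  exact relations.sub_mem (relations.add_mem hrel h1) h2

/-- **THE ASSEMBLY.** Cube-Nash normal form (leaf 1), Ayoub's localised cube kernel modulo Γ (leaf 2)
and `[π]`-cancellation modulo Γ (leaf 3) imply `CompleteModGammaSector`.
[cite: Ayoub2014, Rem. 12–13 and Conj. 7] [cite: KontsevichZagier2001, §1.2 and §4.1] -/
theorem completeModGammaSector_of_ayoubPiSplit (h₁ : CubeNashNormalForm)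
    (h₂ : CubicalPiLocalKernelModGamma) (h₃ : PiCancellationModGamma) : CompleteModGammaSector := by
  rw [completeModGammaSector_iff_ker_le]
  intro c hc
  have hc0 : eval c = 0 := (AddMonoidHom.mem_ker).mp hc
  -- a pinned disc-product operator exists (landed construction): the leaves are not consumed vacuously
  obtain ⟨P, hP⟩ := exists_pinnedProduct
  have hP' : IsPinnedDisc P := hP
  -- leaf 1: reduce `c` to the cubical span
  obtain ⟨a, ha, hca⟩ := exists_cubical_of_cubeNashNormalForm h₁ c
  -- soundness: the cubical representative still evaluates to zero
  have ha0 : eval a = 0 := by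
    have h := relations_le_ker_eval_holds hca
    rw [AddMonoidHom.mem_ker, map_sub, hc0, zero_sub, neg_eq_zero] at h
    exact h
  -- leaf 2: some disc power of `a` is Γ-accessible
  obtain ⟨N, hN⟩ := (cubicalPiLocalKernelModGamma_iff.mp h₂) P hP' a ha ha0
  -- leaf 3: peel the disc factors
  have haS : a ∈ sector :=
    mem_sector_of_iterate_mem ((piCancellationModGamma_iff.mp h₃) P hP') N a hN
  -- conclude: `c = (c - a) + a`, `relations ≤ sector`
  have : c = (c - a) + a := by abel
  rw [this]
  exact sector.add_mem (AddSubgroup.mem_sup_left hca) haS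

/-! ## Honesty certificates: leaves 2 and 3 are consequences of the crux (never stronger than it);
leaf 1 is summit-free geometry (not a consequence). No leaf is the crux: leaf 2 needs leaves 1 AND 3
to give `X`, leaf 3 constrains no value, leaf 1 constrains no value. -/

/-- `eval ∘ liftP P = π · eval` for a pinned operator: `liftP P c ≡ [π] * c` modulo relations
(`BetaCancellationLine.piRep_mul_sub_lift_mem_relations`, landed), relations evaluate to `0`, and
`eval ([π] * c) = π · eval c` (`KZ.eval_piRep_mul`). [folklore] -/
theorem eval_liftP {P : ∀ n : ℕ, IntegralRep n → IntegralRep (n + 2)} (hP : IsPinnedDisc P)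
    (c : FormalRep) : eval (liftP P c) = Real.pi * eval c := by
  have h0 : eval (of piRep * c - liftP P c) = 0 :=
    relations_le_ker_eval_holds (piRep_mul_sub_lift_mem_relations P hP c)
  rw [map_sub, eval_piRep_mul, sub_eq_zero] at h0
  exact h0.symm

/-- **A pinned disc operator preserves the KZ relations** (the transport lemma of leaf 2's birth
skeleton, proved): `liftP P c = [π] * c − ([π] * c − liftP P c)`, the first term a relation by the
left-ideal property `KZ.mul_mem_relations_left_holds`, the second by
`piRep_mul_sub_lift_mem_relations`. [cite: KontsevichZagier2001, §1.2] -/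
theorem liftP_mem_relations {P : ∀ n : ℕ, IntegralRep n → IntegralRep (n + 2)} (hP : IsPinnedDisc P)
    {c : FormalRep} (hc : c ∈ relations) : liftP P c ∈ relations := by
  have h1 : of piRep * c ∈ relations := mul_mem_relations_left_holds c (of piRep) hc
  have h2 := piRep_mul_sub_lift_mem_relations P hP c
  have : liftP P c = of piRep * c - (of piRep * c - liftP P c) := by
    simp only [liftP, sub_sub_cancel]
  rw [this]
  exact relations.sub_mem h1 h2

/-- **The crux implies leaf 3** (unconditionally): `[π]·c ∈ sector ⇒ π · eval c = 0 ⇒ eval c = 0 ⇒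
c ∈ sector`. So leaf 3 is a CONSEQUENCE of `X`, never stronger. [folklore] -/
theorem piCancellationModGamma_of_crux (h : CompleteModGammaSector) : PiCancellationModGamma := by
  rw [piCancellationModGamma_iff]
  intro P hP c hc
  have h0 : eval (liftP P c) = 0 := sector_le_ker_eval hc
  rw [eval_liftP hP] at h0
  have hc0 : eval c = 0 := (mul_eq_zero.mp h0).resolve_left Real.pi_ne_zero
  exact (completeModGammaSector_iff_ker_le.mp h) ((AddMonoidHom.mem_ker).mpr hc0)

/-- The crux implies leaf 2 (exponent `N = 0`). [folklore] -/
theorem cubicalPiLocalKernelModGamma_of_crux (h : CompleteModGammaSector) :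
    CubicalPiLocalKernelModGamma := by
  rw [cubicalPiLocalKernelModGamma_iff]
  intro P _ a _ ha0
  exact ⟨0, (completeModGammaSector_iff_ker_le.mp h) ((AddMonoidHom.mem_ker).mpr ha0)⟩

/-! ## Zero absorption (why compression-type cuts are the crux in costume) -/

/-- **Zero form ⇒ crux.** If every SINGLE representation of value `0` lies in `sector`, the crux
holds: a kernel element is `[r] − [r']` modulo relations; `[r'] + [r'.neg]` is a relation
(`KZ.of_add_of_neg_mem_levelRel`); merge `r` and `r'.neg` into ONE representation `R`
(`KZ.IntegralRep.exists_of_add_of_sub_of_mem_relations`), whose value is `0` by soundness.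
Consequence: any piece asserting that value-zero (or algebraically valued) representations are
Γ-accessible — e.g. the `k = 0` layer of a "degree compression" statement — already implies the crux.
[folklore] -/
theorem completeModGammaSector_of_zeroForm
    (h : ∀ (N : ℕ) (R : IntegralRep N), R.value = 0 → of R ∈ sector) : CompleteModGammaSector := by
  rw [completeModGammaSector_iff_ker_le]
  intro c hc
  have hc0 : eval c = 0 := (AddMonoidHom.mem_ker).mp hc
  obtain ⟨n, m, r, r', hrel⟩ := exists_integralRep_sub_holds c
  have hneg : of r' + of r'.neg ∈ relations := levelRel_le_relations (of_add_of_neg_mem_levelRel r')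
  obtain ⟨K, R, hR⟩ := r.exists_of_add_of_sub_of_mem_relations r'.neg
  have hcR : c - of R ∈ relations := by
    have : c - of R = (c - (of r - of r')) - (of r' + of r'.neg) + (of r + of r'.neg - of R) := by abel
    rw [this]
    exact relations.add_mem (relations.sub_mem hrel hneg) hR
  have hR0 : R.value = 0 := by
    have h := relations_le_ker_eval_holds hcR
    rw [AddMonoidHom.mem_ker, map_sub, hc0, zero_sub, neg_eq_zero, eval_of] at h
    exact h
  have : c = (c - of R) + of R := by abel
  rw [this]
  exact sector.add_mem (AddSubgroup.mem_sup_left hcR) (h K R hR0)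

/-- **Crux ⇔ zero form.** [folklore] -/
theorem completeModGammaSector_iff_zeroForm :
    CompleteModGammaSector ↔ ∀ (N : ℕ) (R : IntegralRep N), R.value = 0 → of R ∈ sector := by
  refine ⟨fun h N R hR => ?_, completeModGammaSector_of_zeroForm⟩
  have : eval (of R) = 0 := by rw [eval_of, hR]
  exact (completeModGammaSector_iff_ker_le.mp h) ((AddMonoidHom.mem_ker).mpr this)

/-! ## Registered stubs of the LINE `ayoub-pi-split` (the three leaves of the split, each its own item
after `route edit --split`; sorries live ONLY here) and the composition concluding the crux BY NAME -/

/-- **Stub 1 = leaf 1** (item stmt-KontsevichZagierPeriods-3574 verbatim). -/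
theorem stub_cubeNashNormalForm : CubeNashNormalForm := by
  sorry

/-- **Stub 2 = leaf 2** (Ayoub's effective cube kernel, localised at `[π]`, modulo Γ). HARDEST. -/
theorem stub_cubicalPiLocalKernelModGamma : CubicalPiLocalKernelModGamma := by
  sorry

/-- **Stub 3 = leaf 3** (`[π]`-cancellation modulo Γ; item 0540 with `relations ↦ sector`). -/
theorem stub_piCancellationModGamma : PiCancellationModGamma := by
  sorry

/-- **The composition**, concluding the crux by name. -/
theorem CompleteModGammaSector_of :
    CubeNashNormalForm → CubicalPiLocalKernelModGamma → PiCancellationModGamma →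
      Summit.KontsevichZagierPeriods.KontsevichZagierPeriods.Theses.TerasomaMultiplication.CompleteModGammaSector :=
  completeModGammaSector_of_ayoubPiSplit

/-- The crux from the registered stubs. -/
theorem completeModGammaSector_of_stubs :
    Summit.KontsevichZagierPeriods.KontsevichZagierPeriods.Theses.TerasomaMultiplication.CompleteModGammaSector :=
  CompleteModGammaSector_of stub_cubeNashNormalForm stub_cubicalPiLocalKernelModGamma
    stub_piCancellationModGamma

end Summit.KontsevichZagierPeriods.KontsevichZagierPeriods.Cruxes.CompleteModGammaSector.AyoubPiSplitLine
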